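import Mathlib
import HarnessLib
import Literature.Analysis.FluidPDE.SlabSuitableCompactness
import Literature.Analysis.FluidPDE.LocalTypeIBlowup.CompactnessLevels

/-!
# Blow-up at a local Type I singular point (Albritton–Barker 2019, Thm. 1.1, forward direction;
# Seregin–Šverák 2009, Thm. 2.8), file 3b:
# compactness of suitable weak solutions defined on growing balls — gluing the levels

Analysis/FluidPDE proof file (theorems only: no definition, no named fact, no `sorry`).  PORT NOTE: this
module is the Literature twin of the Summits-side file
`Summits/NavierStokesRegularity/NavierStokesRegularity/Theorems/HardyPointSinkABForwardHardyCompactness.lean` (prover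
seats of route HardyPointSink, landed 2026-08-16, kernel-checked), carried over verbatim up to the namespace
(`Literature.Analysis.FluidPDE.LocalTypeIBlowup`, topic-aligned) and the provenance tags, so that the Literature named
facts `Literature.Analysis.FluidPDE.AlbrittonBarkerForward` (`LocalTypeICharacterization.lean`) and
`Literature.Analysis.FluidPDE.AlbrittonBarkerTypeICharacterization` (`LocalTypeI.lean`) are discharged INSIDE
`Literature/` (`AlbrittonBarkerForwardHolds.lean`), where `LocalTypeICharacterizationHolds.lean` asks for them; the
Summits copies are the dedup candidates of record (librarian pattern (b), promote request filed 2026-08-26).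
The mathematics is the published blow-up procedure at a local Type I singular point (Seregin–Šverák 2009, §2 and
Thm. 2.8; Albritton–Barker 2019, Prop. 2.4 and §3); nothing here is a claim about Navier–Stokes regularity.

Third helper file for the forward direction of Albritton–Barker 2019, Thm. 1.1 (blow-up at a
Type I singular point).  The tree's `slab_suitableCompactness` (`SlabSuitableCompactness.lean`;
Albritton–Barker 2019, Lemma 2.2 after Lin 1998 on the expanding balls `Q(0, 2ᵐ)`, Seregin
2014, Prop. 6.20) asks every approximant to be a suitable weak solution in **every** ball
`Q(0, 2ᵐ)`.  The rescaled solutions of a blow-up sequence at a local singularity are only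
defined on growing balls: the `k`-th one on `Q(0, 2ᵏ)`, say.  This file records the
**tail-tolerant** version of the same two theorems, with the same proofs: at level `m` only the
approximants `k ≥ m` are required to be suitable in `Q(0, 2ᵐ)` with a uniform
`L³ × L^{3/2}` bound (`local_suitableCompactness_levels`, `local_suitableCompactness`).  The
only changes to the tree proofs are index shifts by `m` (resp. `m + 1`) before the compactness
theorem on the unit ball and before the uniqueness of strong `L³` limits are invoked.

## References

* D. Albritton, T. Barker, J. Math. Fluid Mech. 21 (2019) = arXiv:1811.00502, Lemma 2.2, §3.
* F.-H. Lin, Comm. Pure Appl. Math. 51 (1998), Thm. 2.2.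
* G. Seregin, *Lecture Notes on Regularity Theory for the Navier–Stokes Equations* (2014),
  §6.6, Prop. 6.20.
-/

noncomputable section

open MeasureTheory Set Function Filter Topology TopologicalSpace Metric
open scoped NNReal ENNReal
open Literature.Analysis Literature.Analysis.FluidPDE

namespace Literature.Analysis.FluidPDE.LocalTypeIBlowup

section LocalCompactness

variable {v : ℕ → ℝ → EuclideanSpace ℝ (Fin 3) → EuclideanSpace ℝ (Fin 3)}
  {q : ℕ → ℝ → EuclideanSpace ℝ (Fin 3) → ℝ}

/-- **Compactness of suitable weak solutions on the expanding balls `Q(0, a)`**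
(Albritton–Barker 2019, Lemma 2.2, applied on every `Q(0, 2ᵐ)` "by rescaling"; Seregin 2014,
Prop. 6.20: "for each `a > 0`, `u^{(k)} → u` in `L₃(Q(a))` … and `p^{(k)} ⇀ p` in
`L_{3/2}(Q(a))`").  Let `(v_k, q_k)` be suitable weak solutions in every ball `Q(0, 2ᵐ)` (A–B
Def. 2.1) with `sup_k ‖v_k‖_{L³(Q(0,2ᵐ))} + ‖q_k‖_{L^{3/2}(Q(0,2ᵐ))} < ∞` for every `m`.  Then
there are a strictly increasing `σ` and one pair `(u, p)` such that for **every** `a > 0`: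
`(u, p)` is a suitable weak solution in `Q(0, a)` (`IsSuitableWeakSolutionInBall a 0 u p`),
`u ∈ L³(Q(0, a))`, `v_{σ j} → u` in `L³(Q(0, a))`, and `q_{σ j} ⇀ p` weakly in
`L^{3/2}(Q(0, a))` (tested against `L³(Q(0, a))`).  Proof: the level limits of
`slab_suitableCompactness_levels`, zoomed back to the base scale, are limits of the same
sequence on the balls `Q(0, 2ᵐ R)`, `R < 1`; strong `L³` limits and weak limits are unique, so
consecutive levels agree a.e. and glue along the exhaustion `Q(0, 2ᵐ/2)`; the class
`IsSuitableWeakSolutionInBall` is invariant under zooms and a.e. modification.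
[cite: AlbrittonBarker2019, Lemma 2.2] -/
theorem local_suitableCompactness
    (hball : ∀ (m k : ℕ), m ≤ k → IsSuitableWeakSolutionInBall ((2 : ℝ) ^ m) 0 (v k) (q k))
    (hbd : ∀ m : ℕ, (⨆ k, ⨆ (_ : m ≤ k), (eLpNorm (uncurry (v k)) 3
        (volume.restrict (parabolicCylinder ((2 : ℝ) ^ m) (0 : ℝ × EuclideanSpace ℝ (Fin 3)))) +
      eLpNorm (uncurry (q k)) (3 / 2)
        (volume.restrict (parabolicCylinder ((2 : ℝ) ^ m) (0 : ℝ × EuclideanSpace ℝ (Fin 3)))))) < ∞) :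
    ∃ (u : ℝ → EuclideanSpace ℝ (Fin 3) → EuclideanSpace ℝ (Fin 3))
      (p : ℝ → EuclideanSpace ℝ (Fin 3) → ℝ) (σ : ℕ → ℕ), StrictMono σ ∧
      ∀ a : ℝ, 0 < a →
        IsSuitableWeakSolutionInBall a 0 u p ∧
        MemLp (uncurry u) 3
          (volume.restrict (parabolicCylinder a (0 : ℝ × EuclideanSpace ℝ (Fin 3)))) ∧
        Tendsto (fun j => eLpNorm (uncurry (v (σ j)) - uncurry u) 3
            (volume.restrict (parabolicCylinder a (0 : ℝ × EuclideanSpace ℝ (Fin 3)))))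
          atTop (𝓝 0) ∧
        ∀ g : ℝ × EuclideanSpace ℝ (Fin 3) → ℝ,
          MemLp g 3 (volume.restrict (parabolicCylinder a (0 : ℝ × EuclideanSpace ℝ (Fin 3)))) →
          Tendsto (fun j => ∫ w in parabolicCylinder a (0 : ℝ × EuclideanSpace ℝ (Fin 3)),
              q (σ j) w.1 w.2 * g w)
            atTop (𝓝 (∫ w in parabolicCylinder a (0 : ℝ × EuclideanSpace ℝ (Fin 3)),
              p w.1 w.2 * g w)) := by
  classical
  obtain ⟨σ, hσ, hlev⟩ := local_suitableCompactness_levels hball hbd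
  choose u p hgood using hlev
  -- ## abbreviations
  have hcc_pos : ∀ m : ℕ, 0 < ((2 : ℝ) ^ m) := fun m => by positivity
  set wl : ℕ → ℝ → EuclideanSpace ℝ (Fin 3) → EuclideanSpace ℝ (Fin 3) :=
    fun m => ((2 : ℝ) ^ m)⁻¹ •
      stPull (((2 : ℝ) ^ m)⁻¹ ^ 2) ((2 : ℝ) ^ m)⁻¹ (0 : ℝ) (0 : EuclideanSpace ℝ (Fin 3)) (u m)
    with hwl
  set πl : ℕ → ℝ → EuclideanSpace ℝ (Fin 3) → ℝ :=
    fun m => ((2 : ℝ) ^ m)⁻¹ ^ 2 •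
      stPull (((2 : ℝ) ^ m)⁻¹ ^ 2) ((2 : ℝ) ^ m)⁻¹ (0 : ℝ) (0 : EuclideanSpace ℝ (Fin 3)) (p m)
    with hπl
  -- ## the zoom relations
  have hu_wl : ∀ m, u m = ((2 : ℝ) ^ m) •
      stPull (((2 : ℝ) ^ m) ^ 2) ((2 : ℝ) ^ m) (0 : ℝ) (0 : EuclideanSpace ℝ (Fin 3)) (wl m) :=
    fun m => (zoom_zoom_origin_inv (hcc_pos m).ne' _ _ (mul_inv_cancel₀ (hcc_pos m).ne') (u m)).symm
  have hp_πl : ∀ m, p m =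
      ((2 : ℝ) ^ m) ^ 2 •
        stPull (((2 : ℝ) ^ m) ^ 2) ((2 : ℝ) ^ m) (0 : ℝ) (0 : EuclideanSpace ℝ (Fin 3)) (πl m) :=
    fun m => (zoom_zoom_origin_inv (hcc_pos m).ne' _ _
      (by rw [← mul_pow, mul_inv_cancel₀ (hcc_pos m).ne', one_pow]) (p m)).symm
  have hcyl : ∀ m (R : ℝ), parabolicCylinder R (0 : ℝ × EuclideanSpace ℝ (Fin 3)) =
      parabolicCylinder ((((2 : ℝ) ^ m) * R) / ((2 : ℝ) ^ m)) (0 : ℝ × EuclideanSpace ℝ (Fin 3)) := by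
    intro m R; rw [mul_div_cancel_left₀ R (hcc_pos m).ne']
  have hcyl' : ∀ m (R : ℝ), parabolicCylinder (R / ((2 : ℝ) ^ m)⁻¹) (0 : ℝ × EuclideanSpace ℝ (Fin 3)) =
      parabolicCylinder (((2 : ℝ) ^ m) * R) (0 : ℝ × EuclideanSpace ℝ (Fin 3)) := by
    intro m R; rw [div_inv_eq_mul, mul_comm]
  -- ## (A) strong convergence at level `m`, in the base scale, on `Q(2ᵐ R)`
  have hbase : ∀ m, ∀ R ∈ Ioo (0 : ℝ) 1,
      Tendsto (fun j => eLpNorm (uncurry (v (σ j)) - uncurry (wl m)) 3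
        (volume.restrict (parabolicCylinder (((2 : ℝ) ^ m) * R) (0 : ℝ × EuclideanSpace ℝ (Fin 3)))))
        atTop (𝓝 0) := by
    intro m R hR
    obtain ⟨-, -, h3, -⟩ := hgood m R hR
    set K : ℝ≥0∞ := ‖((2 : ℝ) ^ m)‖ₑ *
      (ENNReal.ofReal (((2 : ℝ) ^ m) ^ 2 * ((2 : ℝ) ^ m) ^ 3)⁻¹) ^ (1 / (3 : ℝ≥0∞).toReal) with hK
    have key : ∀ j, eLpNorm (uncurry (((2 : ℝ) ^ m) • stPull (((2 : ℝ) ^ m) ^ 2) ((2 : ℝ) ^ m) (0 : ℝ)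
          (0 : EuclideanSpace ℝ (Fin 3)) (v (σ j))) - uncurry (u m)) 3
        (volume.restrict (parabolicCylinder R (0 : ℝ × EuclideanSpace ℝ (Fin 3)))) =
        K * eLpNorm (uncurry (v (σ j)) - uncurry (wl m)) 3
          (volume.restrict (parabolicCylinder (((2 : ℝ) ^ m) * R) (0 : ℝ × EuclideanSpace ℝ (Fin 3)))) := by
      intro j
      rw [hu_wl m]
      have e1 : uncurry (((2 : ℝ) ^ m) • stPull (((2 : ℝ) ^ m) ^ 2) ((2 : ℝ) ^ m) (0 : ℝ)
            (0 : EuclideanSpace ℝ (Fin 3)) (v (σ j))) -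
          uncurry (((2 : ℝ) ^ m) • stPull (((2 : ℝ) ^ m) ^ 2) ((2 : ℝ) ^ m) (0 : ℝ)
            (0 : EuclideanSpace ℝ (Fin 3)) (wl m)) =
          uncurry (((2 : ℝ) ^ m) • stPull (((2 : ℝ) ^ m) ^ 2) ((2 : ℝ) ^ m) (0 : ℝ)
            (0 : EuclideanSpace ℝ (Fin 3)) (v (σ j) - wl m)) := by
        funext z
        show _ - _ = ((2 : ℝ) ^ m) • (v (σ j) - wl m) _ _
        rw [Pi.sub_apply, Pi.sub_apply, smul_sub]
        rfl
      rw [e1, hcyl m R, eLpNorm_uncurry_zoom (hcc_pos m) ((2 : ℝ) ^ m) _ (((2 : ℝ) ^ m) * R) (by norm_num)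
        (by norm_num)]
      rfl
    have hK0 : K ≠ 0 := by
      refine mul_ne_zero ?_ ?_
      · rw [Real.enorm_eq_ofReal (hcc_pos m).le]; exact (ENNReal.ofReal_pos.2 (hcc_pos m)).ne'
      · exact (ENNReal.rpow_pos (ENNReal.ofReal_pos.2 (by positivity)) ENNReal.ofReal_ne_top).ne'
    have hKtop : K ≠ ⊤ :=
      ENNReal.mul_ne_top enorm_ne_top (ENNReal.rpow_ne_top_of_nonneg (by positivity) ENNReal.ofReal_ne_top)
    have h3' : Tendsto (fun j => K * eLpNorm (uncurry (v (σ j)) - uncurry (wl m)) 3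
        (volume.restrict (parabolicCylinder (((2 : ℝ) ^ m) * R) (0 : ℝ × EuclideanSpace ℝ (Fin 3)))))
        atTop (𝓝 0) := by
      simpa only [key] using h3
    have h4 := ENNReal.Tendsto.const_mul h3' (Or.inr (ENNReal.inv_ne_top.2 hK0)) (a := K⁻¹)
    simp only [mul_zero, ← mul_assoc, ENNReal.inv_mul_cancel hK0 hKtop, one_mul] at h4
    exact h4
  -- ## (B) weak convergence of the pressures at level `m`, in the base scale, on `Q(2ᵐ R)`
  have hweak : ∀ m, ∀ R ∈ Ioo (0 : ℝ) 1, ∀ g : ℝ × EuclideanSpace ℝ (Fin 3) → ℝ,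
      MemLp g 3 (volume.restrict (parabolicCylinder (((2 : ℝ) ^ m) * R) (0 : ℝ × EuclideanSpace ℝ (Fin 3)))) →
      Tendsto (fun j => ∫ w in parabolicCylinder (((2 : ℝ) ^ m) * R) (0 : ℝ × EuclideanSpace ℝ (Fin 3)),
          q (σ j) w.1 w.2 * g w) atTop
        (𝓝 (∫ w in parabolicCylinder (((2 : ℝ) ^ m) * R) (0 : ℝ × EuclideanSpace ℝ (Fin 3)),
          (πl m) w.1 w.2 * g w)) := by
    intro m R hR g hg
    obtain ⟨-, -, -, h4⟩ := hgood m R hR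
    have hg' : MemLp (g ∘ stAffine (((2 : ℝ) ^ m) ^ 2) ((2 : ℝ) ^ m) (0 : ℝ) (0 : EuclideanSpace ℝ (Fin 3))) 3
        (volume.restrict (parabolicCylinder R (0 : ℝ × EuclideanSpace ℝ (Fin 3)))) := by
      rw [hcyl m R]
      exact memLp_comp_zoom (hcc_pos m) (by norm_num) (by norm_num) hg
    have h5 := h4 _ hg'
    set K : ℝ := ((2 : ℝ) ^ m) ^ 2 * (((2 : ℝ) ^ m) ^ 2 * ((2 : ℝ) ^ m) ^ 3)⁻¹ with hK
    have hK0 : K ≠ 0 := by positivity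
    have key : ∀ ρ : ℝ → EuclideanSpace ℝ (Fin 3) → ℝ,
        ∫ w in parabolicCylinder R (0 : ℝ × EuclideanSpace ℝ (Fin 3)),
          (((2 : ℝ) ^ m) ^ 2 • stPull (((2 : ℝ) ^ m) ^ 2) ((2 : ℝ) ^ m) (0 : ℝ)
            (0 : EuclideanSpace ℝ (Fin 3)) ρ) w.1 w.2 *
            (g ∘ stAffine (((2 : ℝ) ^ m) ^ 2) ((2 : ℝ) ^ m) (0 : ℝ) (0 : EuclideanSpace ℝ (Fin 3))) w =
          K * ∫ w in parabolicCylinder (((2 : ℝ) ^ m) * R) (0 : ℝ × EuclideanSpace ℝ (Fin 3)),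
            ρ w.1 w.2 * g w := by
      intro ρ
      rw [hcyl m R]
      exact setIntegral_zoom_pressure_mul (hcc_pos m) _ ρ g (((2 : ℝ) ^ m) * R)
    simp only [hp_πl m, key] at h5
    have h6 := h5.const_mul K⁻¹
    simp only [← mul_assoc, inv_mul_cancel₀ hK0, one_mul] at h6
    exact h6
  -- ## measurability and integrability
  have hv_meas : ∀ j m, m + 1 ≤ j → ∀ R ∈ Ioo (0 : ℝ) 1, AEStronglyMeasurable (uncurry (v j))
      (volume.restrict (parabolicCylinder (((2 : ℝ) ^ m) * R) (0 : ℝ × EuclideanSpace ℝ (Fin 3)))) := by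
    intro j m hj R hR
    have h1 := (hball (m + 1) j hj).1.distributional.1.aestronglyMeasurable
    refine h1.mono_measure (Measure.restrict_mono ?_ le_rfl)
    refine parabolicCylinder_mono (by have := hcc_pos m; have := hR.1; positivity) ?_ _
    have := hR.2
    rw [pow_succ]
    nlinarith [hcc_pos m]
  have hwl_memLp : ∀ m, ∀ R ∈ Ioo (0 : ℝ) 1, MemLp (uncurry (wl m)) 3
      (volume.restrict (parabolicCylinder (((2 : ℝ) ^ m) * R) (0 : ℝ × EuclideanSpace ℝ (Fin 3)))) := by
    intro m R hR
    obtain ⟨-, h2, -, -⟩ := hgood m R hR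
    have h1 := (memLp_comp_zoom (inv_pos.2 (hcc_pos m)) (by norm_num) (by norm_num) h2).const_smul
      ((2 : ℝ) ^ m)⁻¹
    rw [hcyl'] at h1
    exact h1
  have hπl_memLp : ∀ m, ∀ R ∈ Ioo (0 : ℝ) 1, MemLp (uncurry (πl m)) (3 / 2)
      (volume.restrict (parabolicCylinder (((2 : ℝ) ^ m) * R) (0 : ℝ × EuclideanSpace ℝ (Fin 3)))) := by
    intro m R hR
    obtain ⟨h1, -, -, -⟩ := hgood m R hR
    have h2 := (memLp_comp_zoom (inv_pos.2 (hcc_pos m)) (by norm_num)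
      (ENNReal.div_ne_top (by norm_num) (by norm_num)) h1.2.2.2).const_smul (((2 : ℝ) ^ m)⁻¹ ^ 2)
    rw [hcyl'] at h2
    exact h2
  -- ## (C) consecutive levels agree a.e.
  have hstep_cyl : ∀ m (R : ℝ), ((2 : ℝ) ^ (m + 1)) * (R / 2) = ((2 : ℝ) ^ m) * R := by
    intro m R; rw [pow_succ]; ring
  have hcons_w : ∀ m, ∀ R ∈ Ioo (0 : ℝ) 1,
      ∀ᵐ z ∂(volume.restrict (parabolicCylinder (((2 : ℝ) ^ m) * R) (0 : ℝ × EuclideanSpace ℝ (Fin 3)))),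
        uncurry (wl m) z = uncurry (wl (m + 1)) z := by
    intro m R hR
    have hR2 : R / 2 ∈ Ioo (0 : ℝ) 1 := ⟨by linarith [hR.1], by linarith [hR.2]⟩
    have h1 := (hbase m R hR).comp (tendsto_add_atTop_nat (m + 1))
    have h2 := (hbase (m + 1) (R / 2) hR2).comp (tendsto_add_atTop_nat (m + 1))
    have hm2 := hwl_memLp (m + 1) (R / 2) hR2
    rw [hstep_cyl] at h2 hm2
    have hσm : ∀ j, m + 1 ≤ σ (j + (m + 1)) := fun j =>
      (Nat.le_add_left (m + 1) j).trans (hσ.id_le (j + (m + 1)))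
    exact ae_eq_of_tendsto_eLpNorm_sub (F := fun j => uncurry (v (σ (j + (m + 1))))) (by norm_num)
      (fun j => hv_meas (σ (j + (m + 1))) m (hσm j) R hR) (hwl_memLp m R hR).1 hm2.1 h1 h2
  have hcons_π : ∀ m, ∀ R ∈ Ioo (0 : ℝ) 1,
      ∀ᵐ z ∂(volume.restrict (parabolicCylinder (((2 : ℝ) ^ m) * R) (0 : ℝ × EuclideanSpace ℝ (Fin 3)))),
        uncurry (πl m) z = uncurry (πl (m + 1)) z := by
    intro m R hR
    have hR2 : R / 2 ∈ Ioo (0 : ℝ) 1 := ⟨by linarith [hR.1], by linarith [hR.2]⟩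
    have hm2 := hπl_memLp (m + 1) (R / 2) hR2
    rw [hstep_cyl] at hm2
    refine ae_eq_of_forall_setIntegral_mul_eq (hπl_memLp m R hR) hm2 fun g hg => ?_
    have h1 := hweak m R hR g hg
    have h2 := hweak (m + 1) (R / 2) hR2 g (by rw [hstep_cyl]; exact hg)
    rw [hstep_cyl] at h2
    exact tendsto_nhds_unique h1 h2
  -- iterated consistency
  have hcons_w' : ∀ n m, n ≤ m → ∀ R ∈ Ioo (0 : ℝ) 1,
      ∀ᵐ z ∂(volume.restrict (parabolicCylinder (((2 : ℝ) ^ n) * R) (0 : ℝ × EuclideanSpace ℝ (Fin 3)))),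
        uncurry (wl n) z = uncurry (wl m) z := by
    intro n m hnm R hR
    induction m, hnm using Nat.le_induction with
    | base => exact ae_of_all _ fun z => rfl
    | succ m hnm ih =>
        have hsub : parabolicCylinder (((2 : ℝ) ^ n) * R) (0 : ℝ × EuclideanSpace ℝ (Fin 3)) ⊆
            parabolicCylinder (((2 : ℝ) ^ m) * R) (0 : ℝ × EuclideanSpace ℝ (Fin 3)) :=
          parabolicCylinder_mono (by have := hcc_pos n; have := hR.1; positivity)
            (mul_le_mul_of_nonneg_right (pow_le_pow_right₀ (by norm_num) hnm) hR.1.le) _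
        filter_upwards [ih, ae_restrict_of_ae_restrict_of_subset hsub (hcons_w m R hR)] with z h1 h2
        rw [h1, h2]
  have hcons_π' : ∀ n m, n ≤ m → ∀ R ∈ Ioo (0 : ℝ) 1,
      ∀ᵐ z ∂(volume.restrict (parabolicCylinder (((2 : ℝ) ^ n) * R) (0 : ℝ × EuclideanSpace ℝ (Fin 3)))),
        uncurry (πl n) z = uncurry (πl m) z := by
    intro n m hnm R hR
    induction m, hnm using Nat.le_induction with
    | base => exact ae_of_all _ fun z => rfl
    | succ m hnm ih =>
        have hsub : parabolicCylinder (((2 : ℝ) ^ n) * R) (0 : ℝ × EuclideanSpace ℝ (Fin 3)) ⊆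
            parabolicCylinder (((2 : ℝ) ^ m) * R) (0 : ℝ × EuclideanSpace ℝ (Fin 3)) :=
          parabolicCylinder_mono (by have := hcc_pos n; have := hR.1; positivity)
            (mul_le_mul_of_nonneg_right (pow_le_pow_right₀ (by norm_num) hnm) hR.1.le) _
        filter_upwards [ih, ae_restrict_of_ae_restrict_of_subset hsub (hcons_π m R hR)] with z h1 h2
        rw [h1, h2]
  -- ## (D) gluing along the exhaustion `Q(2ᵐ / 2)`
  have hhalf : ∀ m, ((2 : ℝ) ^ m) * (1 / 2) = ((2 : ℝ) ^ m) / 2 := fun m => by ring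
  have hSm : ∀ m, MeasurableSet (parabolicCylinder (((2 : ℝ) ^ m) / 2) (0 : ℝ × EuclideanSpace ℝ (Fin 3))) :=
    fun m => (isOpen_parabolicCylinder _ _).measurableSet
  set N : ℝ × EuclideanSpace ℝ (Fin 3) → ℕ := fun z =>
    if h : ∃ m : ℕ, z ∈ parabolicCylinder (((2 : ℝ) ^ m) / 2) (0 : ℝ × EuclideanSpace ℝ (Fin 3))
    then Nat.find h else 0 with hN
  have hNS : ∀ z ∈ ⋃ m : ℕ, parabolicCylinder (((2 : ℝ) ^ m) / 2) (0 : ℝ × EuclideanSpace ℝ (Fin 3)),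
      z ∈ parabolicCylinder (((2 : ℝ) ^ (N z)) / 2) (0 : ℝ × EuclideanSpace ℝ (Fin 3)) := by
    intro z hz
    have h : ∃ m : ℕ, z ∈ parabolicCylinder (((2 : ℝ) ^ m) / 2) (0 : ℝ × EuclideanSpace ℝ (Fin 3)) :=
      mem_iUnion.1 hz
    simp only [hN, dif_pos h]
    exact Nat.find_spec h
  have hNle : ∀ m, ∀ z ∈ parabolicCylinder (((2 : ℝ) ^ m) / 2) (0 : ℝ × EuclideanSpace ℝ (Fin 3)),
      N z ≤ m := by
    intro m z hz
    have h : ∃ m : ℕ, z ∈ parabolicCylinder (((2 : ℝ) ^ m) / 2) (0 : ℝ × EuclideanSpace ℝ (Fin 3)) :=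
      ⟨m, hz⟩
    simp only [hN, dif_pos h]
    exact Nat.find_min' h hz
  have hcw : ∀ n m, n ≤ m → ∀ᵐ z ∂(volume.restrict
      (parabolicCylinder (((2 : ℝ) ^ n) / 2) (0 : ℝ × EuclideanSpace ℝ (Fin 3)))),
      uncurry (wl n) z = uncurry (wl m) z := fun n m hnm => by
    have h := hcons_w' n m hnm (1 / 2) (by norm_num); rwa [hhalf] at h
  have hcπ : ∀ n m, n ≤ m → ∀ᵐ z ∂(volume.restrict
      (parabolicCylinder (((2 : ℝ) ^ n) / 2) (0 : ℝ × EuclideanSpace ℝ (Fin 3)))),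
      uncurry (πl n) z = uncurry (πl m) z := fun n m hnm => by
    have h := hcons_π' n m hnm (1 / 2) (by norm_num); rwa [hhalf] at h
  obtain ⟨W, hW, -⟩ := FunctionSpaces.exists_glue_of_ae_eq
    (μ := (volume : Measure (ℝ × EuclideanSpace ℝ (Fin 3)))) hSm N hNS hNle (fun m => uncurry (wl m)) hcw
  obtain ⟨Pg, hPg, -⟩ := FunctionSpaces.exists_glue_of_ae_eq
    (μ := (volume : Measure (ℝ × EuclideanSpace ℝ (Fin 3)))) hSm N hNS hNle (fun m => uncurry (πl m)) hcπ
  set w : ℝ → EuclideanSpace ℝ (Fin 3) → EuclideanSpace ℝ (Fin 3) := fun s y => W (s, y) with hw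
  set π : ℝ → EuclideanSpace ℝ (Fin 3) → ℝ := fun s y => Pg (s, y) with hπ
  -- ## the conclusion on an arbitrary ball `Q(0, a)`
  refine ⟨w, π, σ, hσ, fun a ha => ?_⟩
  obtain ⟨m, hm⟩ := pow_unbounded_of_one_lt (2 * a) (by norm_num : (1 : ℝ) < 2)
  have hm' : a < ((2 : ℝ) ^ m) / 2 := by linarith
  set R : ℝ := a / ((2 : ℝ) ^ m) with hRdef
  have hR : R ∈ Ioo (0 : ℝ) 1 := by
    refine ⟨div_pos ha (hcc_pos m), ?_⟩
    rw [hRdef, div_lt_one (hcc_pos m)]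
    linarith [hcc_pos m]
  have hcR : ((2 : ℝ) ^ m) * R = a := by rw [hRdef, mul_div_cancel₀ a (hcc_pos m).ne']
  have hsubQ : parabolicCylinder a (0 : ℝ × EuclideanSpace ℝ (Fin 3)) ⊆
      parabolicCylinder (((2 : ℝ) ^ m) / 2) (0 : ℝ × EuclideanSpace ℝ (Fin 3)) :=
    parabolicCylinder_mono ha.le hm'.le _
  have hw_a : ∀ᵐ z ∂(volume.restrict (parabolicCylinder a (0 : ℝ × EuclideanSpace ℝ (Fin 3)))),
      uncurry (wl m) z = uncurry w z := by
    filter_upwards [ae_restrict_of_ae_restrict_of_subset hsubQ (hW m)] with z hz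
    rw [← hz]
    rfl
  have hπ_a : ∀ᵐ z ∂(volume.restrict (parabolicCylinder a (0 : ℝ × EuclideanSpace ℝ (Fin 3)))),
      uncurry (πl m) z = uncurry π z := by
    filter_upwards [ae_restrict_of_ae_restrict_of_subset hsubQ (hPg m)] with z hz
    rw [← hz]
    rfl
  obtain ⟨h1, -, -, -⟩ := hgood m R hR
  refine ⟨?_, ?_, ?_, ?_⟩
  · -- suitability
    have h2 := h1.zoomOut (inv_pos.2 (hcc_pos m))
    have e : R / ((2 : ℝ) ^ m)⁻¹ = a := by rw [div_inv_eq_mul, mul_comm, hcR]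
    rw [e] at h2
    exact h2.congr_ae' hw_a hπ_a
  · -- `w ∈ L³(Q(0, a))`
    have h2 := hwl_memLp m R hR
    rw [hcR] at h2
    exact h2.ae_eq hw_a
  · -- strong convergence of the velocities
    have h2 := hbase m R hR
    rw [hcR] at h2
    refine (tendsto_congr fun j => ?_).1 h2
    refine eLpNorm_congr_ae ?_
    filter_upwards [hw_a] with z hz
    show uncurry (v (σ j)) z - uncurry (wl m) z = uncurry (v (σ j)) z - uncurry w z
    rw [hz]
  · -- weak convergence of the pressures
    intro g hg
    have hg' : MemLp g 3 (volume.restrict (parabolicCylinder (((2 : ℝ) ^ m) * R)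
        (0 : ℝ × EuclideanSpace ℝ (Fin 3)))) := by rw [hcR]; exact hg
    have h2 := hweak m R hR g hg'
    rw [hcR] at h2
    have e : ∫ w' in parabolicCylinder a (0 : ℝ × EuclideanSpace ℝ (Fin 3)), (πl m) w'.1 w'.2 * g w' =
        ∫ w' in parabolicCylinder a (0 : ℝ × EuclideanSpace ℝ (Fin 3)), π w'.1 w'.2 * g w' := by
      refine integral_congr_ae ?_
      filter_upwards [hπ_a] with z hz
      change (πl m) z.1 z.2 = π z.1 z.2 at hz
      rw [hz]
    rwa [e] at h2

end LocalCompactness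

end Literature.Analysis.FluidPDE.LocalTypeIBlowup

end
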